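import Mathlib
import HarnessLib
import Summits.CriticalPhenomena.PercolationContinuityZ3.Theorems.PercNearOneGluingNoHeavyQuantFarDecLawDefs

/-!
# QUANT lane R8, front "FAR beyond trees", layer one — CYC-DEC at the law level, file 2: ELEMENTARY BOUNDS
# on the per-position data of a `TwoChain` (the hypotheses of `Block.ratio_C` for the concrete law)

builds on p205010 (kernel theorem, internal audit signed; external expert review pending)

Support file (`--supports stmt-CriticalPhenomena-4575`), seat `prim-quant-p1` (gen 21); memo
`run/shared/lean/prim/quant/prim-quant-p1-g21/FOR-LEAD-CYCDEC.md` §3, §6(2).  Standard axioms; no sorries; no definitions.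

For a valid `TwoChain` (`T/…QuantFarDecLawDefs`): ranges (`0 ≤ ZF, SF, g1, g2, ZQ, SQ`, `ZF + SF ≤ 1`, `ZQ + SQ ≤ 1`), the splittings
`ZF n = ZQ n f · ZF f` and `SF n = SQ n f · ZF f + ZQ n f · SF f` (units under the right arm and in the free zone are independent), the
monotonicity `g2 ≤ g1`, and the four elementary inputs of the ratio inequality (memo §3): `A₁u₁ ≤ g1 (f+1)`, `g1 f ≤ A₁(1 − ZF f)`,
`g2 f ≤ A₁(1 − ZF f − SF f)`, `ZF (f+1) ≤ z₁`; the weights `w ≥ 0` and `Σ_{f=1}^{n} w f = 1 − B 1`.  All by induction on `f`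
along `TwoChain.shift`.
[this work]
-/

namespace Summit.CriticalPhenomena.PercolationContinuityZ3.Theorems

namespace Quant

namespace Block

namespace TwoChain

open Finset

variable {C : TwoChain} {N : ℕ}

/-- Validity is inherited by `shift` with the SAME hub-count parameter (only the pointwise facts and `B = 1` far out are used). [this work] -/
theorem Valid.shift_same (h : C.Valid N) : C.shift.Valid N where
  A_nonneg i := h.A_nonneg (i + 1)
  A_le_one i := h.A_le_one (i + 1)
  A_anti i := h.A_anti (i + 1)
  B_nonneg i := h.B_nonneg (i + 1)
  B_le_one i := h.B_le_one (i + 1)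
  B_mono i := h.B_mono (i + 1)
  B_top j hj := h.B_top (j + 1) (by omega)
  z_nonneg i := h.z_nonneg (i + 1)
  s_nonneg i := h.s_nonneg (i + 1)
  d_nonneg i := h.d_nonneg (i + 1)
  zsd i := h.zsd (i + 1)

/-- `0 ≤ u i`. [this work] -/
theorem u_nonneg (h : C.Valid N) (i : ℕ) : 0 ≤ C.u i := add_nonneg (h.s_nonneg i) (h.d_nonneg i)

/-- `u i + z i = 1`. [this work] -/
theorem u_add_z (h : C.Valid N) (i : ℕ) : C.u i + C.z i = 1 := by unfold u; linarith [h.zsd i]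

/-- `z i ≤ 1`. [this work] -/
theorem z_le_one (h : C.Valid N) (i : ℕ) : C.z i ≤ 1 := by linarith [u_add_z h i, u_nonneg h i]

/-- `u i ≤ 1`. [this work] -/
theorem u_le_one (h : C.Valid N) (i : ℕ) : C.u i ≤ 1 := by linarith [u_add_z h i, h.z_nonneg i]

/-- `A (i+1) ≤ A 1` for every `i` (antitone arm), in the form `A` of the shifted system `≤ A 1`. [this work] -/
theorem A_le_A_one (h : C.Valid N) : ∀ i, C.A (i + 1) ≤ C.A 1 := by
  intro i
  induction i with
  | zero => exact le_rfl
  | succ k ih => exact le_trans (h.A_anti (k + 1)) ih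

/-- `0 ≤ m i ≤ 1`. [this work] -/
theorem m_nonneg (h : C.Valid N) (i : ℕ) : 0 ≤ C.m i := by
  unfold m; nlinarith [h.A_nonneg i, h.B_nonneg i, h.A_le_one i, h.B_le_one i]

/-- `m i ≤ 1`. [this work] -/
theorem m_le_one (h : C.Valid N) (i : ℕ) : C.m i ≤ 1 := by
  unfold m; nlinarith [h.A_nonneg i, h.B_nonneg i, h.A_le_one i, h.B_le_one i]

/-- `A i ≤ m i`. [this work] -/
theorem A_le_m (h : C.Valid N) (i : ℕ) : C.A i ≤ C.m i := by
  unfold m; nlinarith [h.B_nonneg i, h.A_le_one i]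

/-- `0 ≤ ZF f`. [this work] -/
theorem ZF_nonneg (h : C.Valid N) (f : ℕ) : 0 ≤ ZF f C := by
  induction f generalizing C with
  | zero => simp
  | succ k ih => rw [ZF_succ]; exact mul_nonneg (h.z_nonneg 1) (ih h.shift_same)

/-- `ZF f ≤ 1`. [this work] -/
theorem ZF_le_one (h : C.Valid N) (f : ℕ) : ZF f C ≤ 1 := by
  induction f generalizing C with
  | zero => simp
  | succ k ih =>
    rw [ZF_succ]
    have := ih h.shift_same
    have h0 := ZF_nonneg h.shift_same k
    nlinarith [h.z_nonneg 1, z_le_one h 1]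

/-- `0 ≤ SF f`. [this work] -/
theorem SF_nonneg (h : C.Valid N) (f : ℕ) : 0 ≤ SF f C := by
  induction f generalizing C with
  | zero => simp
  | succ k ih =>
    rw [SF_succ]
    exact add_nonneg (mul_nonneg (h.s_nonneg 1) (ZF_nonneg h.shift_same k)) (mul_nonneg (h.z_nonneg 1) (ih h.shift_same))

/-- `ZF f + SF f ≤ 1` (so `DF = 1 − ZF − SF ≥ 0`). [this work] -/
theorem ZF_add_SF_le_one (h : C.Valid N) (f : ℕ) : ZF f C + SF f C ≤ 1 := by
  induction f generalizing C with
  | zero => simp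
  | succ k ih =>
    rw [ZF_succ, SF_succ]
    have h1 := ih h.shift_same
    have hz := ZF_nonneg h.shift_same k
    have hs := SF_nonneg h.shift_same k
    have hzs : C.z 1 + C.s 1 ≤ 1 := by linarith [h.zsd 1, h.d_nonneg 1]
    -- z₁ ZF + s₁ ZF + z₁ SF ≤ (z₁ + s₁) ZF + z₁ SF ≤ ... ≤ 1
    nlinarith [h.z_nonneg 1, h.s_nonneg 1, mul_nonneg (h.z_nonneg 1) hs]

/-- `ZF (f+1) ≤ z 1` (hub 1 belongs to the free zone). [this work] -/
theorem ZF_succ_le_z (h : C.Valid N) (f : ℕ) : ZF (f + 1) C ≤ C.z 1 := by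
  rw [ZF_succ]
  have := ZF_le_one h.shift_same f
  nlinarith [h.z_nonneg 1]

/-- `0 ≤ g1 f`. [this work] -/
theorem g1_nonneg (h : C.Valid N) (f : ℕ) : 0 ≤ g1 f C := by
  induction f generalizing C with
  | zero => simp
  | succ k ih =>
    rw [g1_succ]
    exact add_nonneg (mul_nonneg (h.A_nonneg 1) (u_nonneg h 1)) (mul_nonneg (h.z_nonneg 1) (ih h.shift_same))

/-- `g1 f ≤ A 1 · (1 − ZF f)` (collecting anything needs the arm to pass hub 1, and a unit in the free zone). [this work] -/
theorem g1_le (h : C.Valid N) (f : ℕ) : g1 f C ≤ C.A 1 * (1 - ZF f C) := by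
  induction f generalizing C with
  | zero => simp
  | succ k ih =>
    rw [g1_succ, ZF_succ]
    have h1 := ih h.shift_same
    simp only [shift_A] at h1
    have hA : C.A 2 ≤ C.A 1 := h.A_anti 1
    have hF := ZF_le_one h.shift_same k
    have hz := h.z_nonneg 1
    -- z₁ g1' ≤ z₁ A₂ (1 − ZF') ≤ z₁ A₁ (1 − ZF'); then A₁u₁ + z₁A₁(1 − ZF') = A₁(1 − z₁ ZF') using u₁ + z₁ = 1
    have e1 : C.z 1 * g1 k C.shift ≤ C.z 1 * (C.A 1 * (1 - ZF k C.shift)) := by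
      apply mul_le_mul_of_nonneg_left _ hz
      exact le_trans h1 (mul_le_mul_of_nonneg_right hA (by linarith))
    have e2 : C.A 1 * C.u 1 + C.z 1 * (C.A 1 * (1 - ZF k C.shift)) = C.A 1 * (1 - C.z 1 * ZF k C.shift) := by
      have hu : C.u 1 = 1 - C.z 1 := by linarith [u_add_z h 1]
      rw [hu]; ring
    linarith

/-- `g1 f ≤ A 1`. [this work] -/
theorem g1_le_A (h : C.Valid N) (f : ℕ) : g1 f C ≤ C.A 1 := by
  have := g1_le h f
  nlinarith [ZF_nonneg h f, h.A_nonneg 1]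

/-- `A 1 · u 1 ≤ g1 (f+1)` (the first hub alone). [this work] -/
theorem g1_succ_ge (h : C.Valid N) (f : ℕ) : C.A 1 * C.u 1 ≤ g1 (f + 1) C := by
  rw [g1_succ]
  have := mul_nonneg (h.z_nonneg 1) (g1_nonneg h.shift_same f)
  linarith

/-- `0 ≤ g2 f`. [this work] -/
theorem g2_nonneg (h : C.Valid N) (f : ℕ) : 0 ≤ g2 f C := by
  induction f generalizing C with
  | zero => simp
  | succ k ih =>
    rw [g2_succ]
    exact add_nonneg (add_nonneg (mul_nonneg (h.A_nonneg 1) (h.d_nonneg 1))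
      (mul_nonneg (h.s_nonneg 1) (g1_nonneg h.shift_same k))) (mul_nonneg (h.z_nonneg 1) (ih h.shift_same))

/-- `g2 f ≤ g1 f`. [this work] -/
theorem g2_le_g1 (h : C.Valid N) (f : ℕ) : g2 f C ≤ g1 f C := by
  induction f generalizing C with
  | zero => simp
  | succ k ih =>
    rw [g2_succ, g1_succ]
    have h1 := ih h.shift_same
    have h2 : g1 k C.shift ≤ C.A 1 := by
      have := g1_le_A h.shift_same k; simp only [shift_A] at this; exact le_trans this (h.A_anti 1)
    -- A₁d₁ + s₁ g1' + z₁ g2' ≤ A₁ d₁ + A₁ s₁ + z₁ g1' = A₁ u₁ + z₁ g1'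
    have e1 : C.s 1 * g1 k C.shift ≤ C.s 1 * C.A 1 := mul_le_mul_of_nonneg_left h2 (h.s_nonneg 1)
    have e2 : C.z 1 * g2 k C.shift ≤ C.z 1 * g1 k C.shift := mul_le_mul_of_nonneg_left h1 (h.z_nonneg 1)
    unfold u; nlinarith

/-- `g2 f ≤ A 1 · (1 − ZF f − SF f)` (two units in the free zone are needed). [this work] -/
theorem g2_le (h : C.Valid N) (f : ℕ) : g2 f C ≤ C.A 1 * (1 - ZF f C - SF f C) := by
  induction f generalizing C with
  | zero => simp
  | succ k ih =>
    rw [g2_succ, ZF_succ, SF_succ]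
    have h1 := ih h.shift_same
    simp only [shift_A] at h1
    have h2 := g1_le h.shift_same k
    simp only [shift_A] at h2
    have hA : C.A 2 ≤ C.A 1 := h.A_anti 1
    have hF := ZF_le_one h.shift_same k
    have hFS := ZF_add_SF_le_one h.shift_same k
    have hS := SF_nonneg h.shift_same k
    have hz := h.z_nonneg 1
    have hs := h.s_nonneg 1
    -- s₁ g1' ≤ s₁ A₁ (1 − ZF'),  z₁ g2' ≤ z₁ A₁ (1 − ZF' − SF')
    have e1 : C.s 1 * g1 k C.shift ≤ C.s 1 * (C.A 1 * (1 - ZF k C.shift)) := by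
      apply mul_le_mul_of_nonneg_left _ hs
      exact le_trans h2 (mul_le_mul_of_nonneg_right hA (by linarith))
    have e2 : C.z 1 * g2 k C.shift ≤ C.z 1 * (C.A 1 * (1 - ZF k C.shift - SF k C.shift)) := by
      apply mul_le_mul_of_nonneg_left _ hz
      exact le_trans h1 (mul_le_mul_of_nonneg_right hA (by linarith))
    have e3 : C.A 1 * C.d 1 + C.s 1 * (C.A 1 * (1 - ZF k C.shift)) + C.z 1 * (C.A 1 * (1 - ZF k C.shift - SF k C.shift))
        = C.A 1 * (1 - C.z 1 * ZF k C.shift - (C.s 1 * ZF k C.shift + C.z 1 * SF k C.shift)) := by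
      have hd : C.d 1 = 1 - C.z 1 - C.s 1 := by linarith [h.zsd 1]
      rw [hd]; ring
    linarith

/-- `0 ≤ ZQ n f`. [this work] -/
theorem ZQ_nonneg (h : C.Valid N) (n f : ℕ) : 0 ≤ ZQ n f C := by
  induction n generalizing f C with
  | zero => cases f <;> simp
  | succ k ih =>
    cases f with
    | zero => rw [ZQ_zero_right]; exact ZF_nonneg h _
    | succ g => rw [ZQ_succ_succ]; exact ih h.shift_same g

/-- `0 ≤ SQ n f`. [this work] -/
theorem SQ_nonneg (h : C.Valid N) (n f : ℕ) : 0 ≤ SQ n f C := by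
  induction n generalizing f C with
  | zero => cases f <;> simp
  | succ k ih =>
    cases f with
    | zero => rw [SQ_zero_right]; exact SF_nonneg h _
    | succ g => rw [SQ_succ_succ]; exact ih h.shift_same g

/-- `ZQ n f + SQ n f ≤ 1`. [this work] -/
theorem ZQ_add_SQ_le_one (h : C.Valid N) (n f : ℕ) : ZQ n f C + SQ n f C ≤ 1 := by
  induction n generalizing f C with
  | zero => cases f <;> simp
  | succ k ih =>
    cases f with
    | zero => rw [ZQ_zero_right, SQ_zero_right]; exact ZF_add_SF_le_one h _
    | succ g => rw [ZQ_succ_succ, SQ_succ_succ]; exact ih h.shift_same g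

/-- Splitting of "no unit at all": `ZF n = ZQ n f · ZF f` for `f ≤ n`. [this work] -/
theorem ZF_split (n f : ℕ) (hf : f ≤ n) (C : TwoChain) : ZF n C = ZQ n f C * ZF f C := by
  induction n generalizing f C with
  | zero =>
    have : f = 0 := by omega
    subst this; simp
  | succ k ih =>
    cases f with
    | zero => simp
    | succ g =>
      rw [ZF_succ, ZQ_succ_succ, ZF_succ, ih g (by omega) C.shift]; ring

/-- Splitting of "exactly one unit": `SF n = SQ n f · ZF f + ZQ n f · SF f` for `f ≤ n`. [this work] -/
theorem SF_split (n f : ℕ) (hf : f ≤ n) (C : TwoChain) : SF n C = SQ n f C * ZF f C + ZQ n f C * SF f C := by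
  induction n generalizing f C with
  | zero =>
    have : f = 0 := by omega
    subst this; simp
  | succ k ih =>
    cases f with
    | zero => simp
    | succ g =>
      rw [SF_succ, SQ_succ_succ, ZQ_succ_succ, ZF_succ, SF_succ, ih g (by omega) C.shift, ZF_split k g (by omega) C.shift]
      ring

/-- `0 ≤ w f` (the right arm's reach is monotone). [this work] -/
theorem w_nonneg (h : C.Valid N) (f : ℕ) : 0 ≤ C.w f := by unfold w; linarith [h.B_mono f]

/-- `Σ_{f=1}^{n} w f = 1 − B 1` for a system valid with `n` hubs (`B (n+1) = 1`; telescoping). [this work] -/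
theorem sum_w {n : ℕ} (h : C.Valid n) : ∑ f ∈ range n, C.w (f + 1) = 1 - C.B 1 := by
  have tel : ∀ k, ∑ f ∈ range k, C.w (f + 1) = C.B (k + 1) - C.B 1 := by
    intro k
    induction k with
    | zero => simp
    | succ j ih => rw [sum_range_succ, ih]; unfold w; ring
  rw [tel n, h.B_succ]

end TwoChain

end Block

end Quant

end Summit.CriticalPhenomena.PercolationContinuityZ3.Theorems
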